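import Summits.ValiantsHypothesis.ValiantsHypothesis.Theorems.ZeroOneTransfer.Negative.TopComponentFree
import Literature.Computability.AlgebraicComplexity.ValiantClassesProofs

/-!
# `ZeroOneTransfer` — negative lemma: DIVISION-EASINESS DESCENDS TO EVERY FACE AND EVERY
# POSITIVE SPECIALISATION (kill criteria by degeneration; route consistency)

Crux `stmt-ValiantsHypothesis-5066` (`Theses.DivisionGap.ZeroOneTransfer`, route DivisionGap).
Standing disprover (cdisprove gen 2), `Cruxes/ZeroOneTransfer/Disproof.lean` §(D).

Over the semifield `ℝ≥0` nothing cancels, so the Hrubeš–Yehudayoff division complexity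
`divComplexity f = min_{h ≠ 0} L(f·h) + L(h)` is monotone under the two degenerations a
refutation may apply first:

* `divComplexity_topComponent_le` — **initial forms are free for division complexity**:
  `divC (top_w f) ≤ divC f` for every weight `w` (`top_w (f h) = top_w f · top_w h`,
  `top_w h ≠ 0`, and `complexity_topComponent_le`);
* `divComplexity_aeval_le_of_pos` — **positive specialisations are free**: substituting
  variables and NONZERO constants does not increase `divC` (the cofactor stays nonzero:
  `aeval_ne_zero_of_pos`).

Consequences filed here (all `sorry`-free):

* `zeroOneTransfer_false_of_hard_face` — KILL CRITERION (D): a 0/1 `VP_ℂ` family ONE of whose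
  face polynomials (`top_{w n} (f n)`) has super-quasi-polynomial division complexity refutes
  the crux.  (Equivalently the crux implies the card's `FaceClosure`.)
* `not_perDivisionHard_and_zeroOneTransfer_of_perFace` — ROUTE CONSISTENCY: if the permanent
  `per_{m n}` (`n ≤ m n`) occurs, up to renaming, as a face polynomial of some 0/1 `VP_ℂ` family,
  then the route's two cruxes `PerDivisionHard` (H1) and `ZeroOneTransfer` (H2) cannot both
  hold.  So H1 ∧ H2 silently asserts "the permanent is not an initial form of any 0/1 `VP`
  family" — a (weak) border-complexity statement: initial forms of `VP` families lie in the
  closure `VP‾`, and `VNP ⊄ VP‾` is the Mulmuley–Sohoni strengthening of Valiant's hypothesis,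
  so no cheap kill is expected along this line, but every proof of H1 ∧ H2 proves that much
  border complexity for free.
[folklore] [cite: HrubesYehudayoff2021, §6]
-/

namespace Summit.ValiantsHypothesis.ValiantsHypothesis.Theorems.ZeroOneTransfer.Negative

set_option linter.dupNamespace false

open Literature.Computability.AlgebraicComplexity
open MvPolynomial Finset
open scoped NNReal

noncomputable section

/-! ### Division complexity (Hrubeš–Yehudayoff normal form) -/

section DivComplexity

variable {k : Type*} [CommSemiring k] {σ : Type*}

/-- Division complexity of `f ∈ k[σ]` in the Hrubeš–Yehudayoff monotone-multiple normal form: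
the least `L(f·h) + L(h)` over nonzero cofactors `h` (over `ℝ≥0`: subtraction-free complexity
with one division, up to `O(1)`).  Same definition as `Cruxes/ZeroOneTransfer/Disproof.lean`.
[cite: HrubesYehudayoff2021, §6] -/
def divComplexity (f : MvPolynomial σ k) : ℕ :=
  sInf {s | ∃ h : MvPolynomial σ k, h ≠ 0 ∧ complexity (f * h) + complexity h = s}

/-- Any nonzero cofactor bounds the division complexity. [folklore] -/
theorem divComplexity_le_of_ne_zero (f : MvPolynomial σ k) {h : MvPolynomial σ k} (hh : h ≠ 0) :
    divComplexity f ≤ complexity (f * h) + complexity h :=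
  Nat.sInf_le ⟨h, hh, rfl⟩

/-- The defining set of `divComplexity f` is attained (nonempty via `h = 1`). [folklore] -/
theorem exists_eq_divComplexity [Nontrivial k] (f : MvPolynomial σ k) :
    ∃ h : MvPolynomial σ k, h ≠ 0 ∧ complexity (f * h) + complexity h = divComplexity f :=
  Nat.sInf_mem (⟨_, 1, one_ne_zero, rfl⟩ :
    Set.Nonempty {s | ∃ h : MvPolynomial σ k, h ≠ 0 ∧ complexity (f * h) + complexity h = s})

end DivComplexity

/-! ### Initial forms are free for division complexity -/

section Top

variable {σ : Type*}

/-- **`divC (top_w f) ≤ divC f`** over `ℝ≥0`, for every weight `w : σ → ℕ`: take an optimal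
cofactor `h`; `top_w (f h) = top_w f · top_w h` (`topComponent_mul`), `top_w h ≠ 0`
(`topComponent_ne_zero`), and both `top_w (f h)` and `top_w h` are no harder than `f h`, `h`
(`complexity_topComponent_le`).  So the class of division-easy families is closed under all
toric degenerations, at zero cost (lemma B2 of crux card `free-degeneration`). [folklore] -/
theorem divComplexity_topComponent_le (w : σ → ℕ) (f : MvPolynomial σ ℝ≥0) :
    divComplexity (topComponent w f) ≤ divComplexity f := by
  obtain ⟨h, hne, heq⟩ := exists_eq_divComplexity f
  rw [← heq]
  calc divComplexity (topComponent w f)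
      ≤ complexity (topComponent w f * topComponent w h) + complexity (topComponent w h) :=
        divComplexity_le_of_ne_zero _ (topComponent_ne_zero w hne)
    _ = complexity (topComponent w (f * h)) + complexity (topComponent w h) := by
        rw [topComponent_mul]
    _ ≤ complexity (f * h) + complexity h :=
        Nat.add_le_add (complexity_topComponent_le w _) (complexity_topComponent_le w _)

end Top

/-! ### Positive specialisations are free for division complexity -/

section Pos

variable {σ τ : Type*}

/-- Evaluation commutes with substitution. [folklore] -/
theorem eval_aeval_eq {R : Type*} [CommSemiring R] (x : τ → R) (e : σ → MvPolynomial τ R)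
    (p : MvPolynomial σ R) : eval x (aeval e p) = eval (fun i => eval x (e i)) p := by
  induction p using MvPolynomial.induction_on with
  | C a => simp
  | add p q hp hq => rw [map_add, map_add, hp, hq, map_add]
  | mul_X p i hp => rw [map_mul, map_mul, hp, aeval_X, map_mul, eval_X]

/-- Over `ℝ≥0` a nonzero polynomial does not vanish at a point with nonzero coordinates.
[folklore] -/
theorem eval_ne_zero_of_ne_zero {p : MvPolynomial σ ℝ≥0} (hp : p ≠ 0) {y : σ → ℝ≥0}
    (hy : ∀ i, y i ≠ 0) : eval y p ≠ 0 := by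
  classical
  obtain ⟨d, hd⟩ := exists_coeff_ne_zero hp
  rw [eval_eq]
  intro h0
  have hterm : coeff d p * ∏ i ∈ d.support, y i ^ d i ≠ 0 :=
    mul_ne_zero hd (Finset.prod_ne_zero_iff.mpr fun i _ => pow_ne_zero _ (hy i))
  have hle : coeff d p * ∏ i ∈ d.support, y i ^ d i ≤
      ∑ e ∈ p.support, coeff e p * ∏ i ∈ e.support, y i ^ e i :=
    Finset.single_le_sum (f := fun e => coeff e p * ∏ i ∈ e.support, y i ^ e i)
      (fun _ _ => zero_le) (mem_support_iff.mpr hd)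
  rw [h0] at hle
  exact hterm (le_antisymm hle zero_le)

/-- A POSITIVE substitution (variables, or NONZERO constants) keeps nonzero polynomials nonzero
over `ℝ≥0` (evaluate at the all-ones point). [folklore] -/
theorem aeval_ne_zero_of_pos (e : σ → MvPolynomial τ ℝ≥0)
    (he : ∀ i, (∃ j, e i = X j) ∨ ∃ c : ℝ≥0, c ≠ 0 ∧ e i = C c)
    {p : MvPolynomial σ ℝ≥0} (hp : p ≠ 0) : aeval e p ≠ 0 := by
  intro h0
  have h1 : eval (fun _ => (1 : ℝ≥0)) (aeval e p) = 0 := by rw [h0, map_zero]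
  rw [eval_aeval_eq] at h1
  refine eval_ne_zero_of_ne_zero hp (y := fun i => eval (fun _ => (1 : ℝ≥0)) (e i)) ?_ h1
  intro i
  rcases he i with ⟨j, hj⟩ | ⟨c, hc, hci⟩
  · rw [hj, eval_X]; exact one_ne_zero
  · rw [hci, eval_C]; exact hc

/-- **`divC (f(e)) ≤ divC f` for positive substitutions** `e` (each variable to a variable or a
nonzero constant): substitute into both circuits of an optimal certificate `f·h = g`; the
cofactor `h(e)` stays nonzero (`aeval_ne_zero_of_pos`) and projections cost nothing
(`complexity_le_of_isProjection`).  Lemma A1 of crux card `arborescence-span`; used by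
refuters to degenerate a `VP` family before attacking it. [folklore] -/
theorem divComplexity_aeval_le_of_pos (e : σ → MvPolynomial τ ℝ≥0)
    (he : ∀ i, (∃ j, e i = X j) ∨ ∃ c : ℝ≥0, c ≠ 0 ∧ e i = C c) (f : MvPolynomial σ ℝ≥0) :
    divComplexity (aeval e f) ≤ divComplexity f := by
  obtain ⟨h, hne, heq⟩ := exists_eq_divComplexity f
  rw [← heq]
  have hproj : ∀ p : MvPolynomial σ ℝ≥0, IsProjection (aeval e p) p := fun p =>
    ⟨e, fun i => (he i).imp id (fun ⟨c, _, hc⟩ => ⟨c, hc⟩), rfl⟩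
  calc divComplexity (aeval e f)
      ≤ complexity (aeval e f * aeval e h) + complexity (aeval e h) :=
        divComplexity_le_of_ne_zero _ (aeval_ne_zero_of_pos e he hne)
    _ = complexity (aeval e (f * h)) + complexity (aeval e h) := by rw [map_mul]
    _ ≤ complexity (f * h) + complexity h :=
        Nat.add_le_add (complexity_le_of_isProjection (hproj _))
          (complexity_le_of_isProjection (hproj _))

/-- Injective renamings do not change division complexity downwards: `divC p ≤ divC (rename ι p)`
(pull back along `ι`, sending the unused variables to `1`). [folklore] -/
theorem divComplexity_le_rename {ι : σ → τ} (hι : Function.Injective ι) [DecidableEq τ]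
    (p : MvPolynomial σ ℝ≥0) : divComplexity p ≤ divComplexity (rename ι p) := by
  classical
  -- the pull-back substitution
  let e : τ → MvPolynomial σ ℝ≥0 := fun v =>
    if hv : ∃ i, ι i = v then X hv.choose else C 1
  have he : ∀ v, (∃ j, e v = X j) ∨ ∃ c : ℝ≥0, c ≠ 0 ∧ e v = C c := by
    intro v
    by_cases hv : ∃ i, ι i = v
    · left; exact ⟨hv.choose, by simp [e, hv]⟩
    · right; exact ⟨1, one_ne_zero, by simp [e, hv]⟩
  have hpull : aeval e (rename ι p) = p := by
    rw [aeval_rename]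
    have hcomp : (e ∘ ι) = X := by
      funext i
      have hv : ∃ i', ι i' = ι i := ⟨i, rfl⟩
      simp only [Function.comp_apply, e, dif_pos hv]
      congr 1
      exact hι hv.choose_spec
    rw [hcomp, aeval_X_left, AlgHom.id_apply]
  calc divComplexity p = divComplexity (aeval e (rename ι p)) := by rw [hpull]
    _ ≤ divComplexity (rename ι p) := divComplexity_aeval_le_of_pos e he _

end Pos

/-! ### (D) Kill criterion: a hard face kills the crux -/

section Kill

open Summit.ValiantsHypothesis.ValiantsHypothesis.Theses.DivisionGap
  (ZeroOneTransfer PerDivisionHard)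

/-- The crux bounds the division complexity of EVERY FACE of every 0/1 `VP_ℂ` family
(the card's `FaceClosure`, a consequence of the crux by `divComplexity_topComponent_le`).
[folklore] -/
theorem isQPBounded_divComplexity_face_of_zeroOneTransfer (H : ZeroOneTransfer)
    (σ : ℕ → Type) [∀ n, Fintype (σ n)] (f : ∀ n, MvPolynomial (σ n) ℝ≥0)
    (w : ∀ n, σ n → ℕ) (h01 : ∀ n m, coeff m (f n) = 0 ∨ coeff m (f n) = 1)
    (hVP : IsVPFamily (k := ℂ) fun n => map (Complex.ofRealHom.comp NNReal.toRealHom) (f n)) :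
    IsQPBounded fun n => divComplexity (topComponent (w n) (f n)) := by
  obtain ⟨c, hc⟩ := H σ f h01 hVP
  refine ⟨c, fun n => ?_⟩
  obtain ⟨h, hne, hle⟩ := hc n
  exact ((divComplexity_topComponent_le (w n) (f n)).trans
    (divComplexity_le_of_ne_zero _ hne)).trans hle

/-- **Kill criterion (D).**  A 0/1 `VP_ℂ` family with ONE super-quasi-polynomially
division-hard face polynomial refutes `ZeroOneTransfer`.  (The cheapest place to break the
crux: faces of `VP` families are only known to lie in the border class `VP‾`, not in `VP`.)
[folklore] -/
theorem zeroOneTransfer_false_of_hard_face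
    (hex : ∃ (σ : ℕ → Type) (_ : ∀ n, Fintype (σ n)) (f : ∀ n, MvPolynomial (σ n) ℝ≥0)
      (w : ∀ n, σ n → ℕ), (∀ n m, coeff m (f n) = 0 ∨ coeff m (f n) = 1) ∧
      IsVPFamily (k := ℂ) (fun n => map (Complex.ofRealHom.comp NNReal.toRealHom) (f n)) ∧
      ¬ IsQPBounded fun n => divComplexity (topComponent (w n) (f n))) :
    ¬ ZeroOneTransfer := by
  intro H
  obtain ⟨σ, _, f, w, h01, hVP, hnot⟩ := hex
  exact hnot (isQPBounded_divComplexity_face_of_zeroOneTransfer H σ f w h01 hVP)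

/-- **Route consistency: H1 ∧ H2 ⇒ the permanent is not a face of a 0/1 `VP` family.**
If for some 0/1 `VP_ℂ` family `f`, weights `w n` and sizes `m n ≥ n`, the face polynomial
`top_{w n} (f n)` is the permanent `per_{m n}` up to an injective renaming of its variables,
then `PerDivisionHard ∧ ZeroOneTransfer` fails: H2 makes the face, hence (renaming and
initial forms being free) `per_{m n}`, division-easy at level `2^((log₂ n + c)^c) ≤
2^((log₂ (m n) + c)^c)` for ALL `n`, and H1 with the same `c` forbids this from `n₀` on.
[folklore] -/
theorem not_perDivisionHard_and_zeroOneTransfer_of_perFace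
    (hex : ∃ (σ : ℕ → Type) (_ : ∀ n, Fintype (σ n)) (_ : ∀ n, DecidableEq (σ n))
      (f : ∀ n, MvPolynomial (σ n) ℝ≥0) (w : ∀ n, σ n → ℕ) (m : ℕ → ℕ)
      (ι : ∀ n, Fin (m n) × Fin (m n) → σ n),
      (∀ n m', coeff m' (f n) = 0 ∨ coeff m' (f n) = 1) ∧
      IsVPFamily (k := ℂ) (fun n => map (Complex.ofRealHom.comp NNReal.toRealHom) (f n)) ∧
      (∀ n, n ≤ m n) ∧ (∀ n, Function.Injective (ι n)) ∧
      ∀ n, topComponent (w n) (f n) = rename (ι n) (perPoly (Fin (m n)) ℝ≥0)) :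
    ¬ (PerDivisionHard ∧ ZeroOneTransfer) := by
  rintro ⟨H1, H2⟩
  obtain ⟨σ, _, _, f, w, m, ι, h01, hVP, hm, hι, hface⟩ := hex
  obtain ⟨c, hc⟩ := isQPBounded_divComplexity_face_of_zeroOneTransfer H2 σ f w h01 hVP
  obtain ⟨n₀, hn₀⟩ := H1 c
  -- division complexity of `per_{m n₀}`
  have hper : divComplexity (perPoly (Fin (m n₀)) ℝ≥0) ≤ 2 ^ ((Nat.log 2 n₀ + c) ^ c) := by
    calc divComplexity (perPoly (Fin (m n₀)) ℝ≥0)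
        ≤ divComplexity (rename (ι n₀) (perPoly (Fin (m n₀)) ℝ≥0)) :=
          divComplexity_le_rename (hι n₀) _
      _ = divComplexity (topComponent (w n₀) (f n₀)) := by rw [hface]
      _ ≤ 2 ^ ((Nat.log 2 n₀ + c) ^ c) := hc n₀
  obtain ⟨h, hne, heq⟩ := exists_eq_divComplexity (perPoly (Fin (m n₀)) ℝ≥0)
  have hlt := hn₀ (m n₀) (hm n₀) h hne
  have hmono : 2 ^ ((Nat.log 2 n₀ + c) ^ c) ≤ 2 ^ ((Nat.log 2 (m n₀) + c) ^ c) :=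
    Nat.pow_le_pow_right two_pos
      (Nat.pow_le_pow_left (Nat.add_le_add_right (Nat.log_mono_right (hm n₀)) c) c)
  rw [heq] at hlt
  exact absurd (hmono.trans_lt hlt) (not_lt.mpr hper)

end Kill

end

end Summit.ValiantsHypothesis.ValiantsHypothesis.Theorems.ZeroOneTransfer.Negative
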